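import Mathlib.CategoryTheory.Adjunction.Limits
import Literature.AlgebraicGeometry.Frobenioids.PreFrobenioidDataToFunctor
import Literature.AlgebraicGeometry.Frobenioids.PreFrobenioidEquivalence
import Literature.AnabelianGeometry.EtaleTheta.TemperedFrobenioidCor38Sub

/-!
# [EtTh] Corollary 3.8 (i) sub-DAG — row C38-L06 (derivation) PROVED: transport of the criterion C38-L05
# along the equivalence of perfections

Mochizuki, *The étale theta function …*, Publ. RIMS **45** (2009), Cor. 3.8, proof PDF p.81 l.20–28: the
intrinsic criterion for base-field-theoretic pre-steps ("its image `A → B` in `C_i^pf` may be written as a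
[filtered] projective limit in `(C_i^pf)^coa-pre_B` of pre-steps abstractly equivalent to an endomorphism that
belongs to '`O^▷(−)`'") followed by "Thus, `Ψ` preserves the base-field-theoretic pre-steps"
[cite: MochizukiEtTh2009, Cor 3.8 p.81]. abc-iut cell, layer L2, seat abc-iut-w5-d124; companion (two bookkeeping
functors, otherwise theorems) of `TemperedFrobenioidCor38Sub.lean` (p414329, plan/L2/SUBDAG-EtTh-Cor38.md),
discharging its row **C38-L06 derivation** `Cor38Hyp.PreservesBsFldPreStepsOfCriterion`:
`Cor38Hyp.preservesBsFldPreSteps_of_criterion` — given the criterion on both sides (C38-L05), an equivalence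
`Ψ^pf : C₁^pf ⥲ C₂^pf` `1`-commuting with `Ψ` (C38-L03) and preserving co-angular pre-steps and `O^▷(−)` of the
perfections ([FrdI] Thm. 3.4 (ii)/(iv) for `Ψ^pf`), `Ψ` and `Ψ⁻¹` preserve base-field-theoretic pre-steps.
ENGINE (`Cor38Transport`): an equivalence between the categories `(C^pf)^coa-pre_B` of co-angular pre-steps over
`B` carrying "O^▷-like" pre-steps to "O^▷-like" ones transports cofiltered limits, hence the criterion
(`isLimitOfOTriLike_transport`); instances: `Over.post Ψ^pf` restricted (`postCoa`, an equivalence: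
`postCoa_isEquivalence`) and `Over.map` along an isomorphism of the base (`mapCoa`), giving transport along
`Ψ^pf` (`isLimitOfOTriLike_map`) and invariance under isomorphism of arrows (`isLimitOfOTriLike_of_arrow_iso`);
plus the iso-invariance of co-angular pre-steps in L1's operations language (via found's `toFunctor` form).
HONEST FRAMING: refereed pre-IUT material; nothing here bears on [IUTchIII] Cor. 3.12; C38-L05 itself stays OPEN.
-/

namespace Literature.AnabelianGeometry.EtaleTheta

open CategoryTheory Opposite Limits Literature.AlgebraicGeometry.Frobenioids

universe u₀ v₀ u v w

namespace Cor38Transport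

/-! ### §1 Iso-invariance of "co-angular pre-step" for a `PreFrobenioidData` (via found's functor form) -/

section OpsIso

variable {E : Type*} [Category E] {B : Type*} [Category B] (S : PreFrobenioidData E B)

/-- Pre-composition with an isomorphism preserves co-angular pre-steps, for the operations language
`PreFrobenioidData` (transfer of found's `PreFrobenioid.IsCoAngularPreStep.iso_comp` along `S.toFunctor`).
[cite: MochizukiFrdI2008, Def. 1.3 (iii) p.25] -/
theorem isCoAngularPreStep_iso_comp {A' A X : E} (c : A' ⟶ A) [IsIso c] {φ : A ⟶ X}
    (hφ : S.IsCoAngularPreStep φ) : S.IsCoAngularPreStep (c ≫ φ) := by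
  have h1 : PreFrobenioid.IsCoAngularPreStep S.toFunctor φ :=
    ⟨(PreFrobenioidData.ofFunctor_isCoAngular S.toFunctor φ).1 hφ.1, hφ.2⟩
  have h2 := h1.iso_comp c
  exact ⟨(PreFrobenioidData.ofFunctor_isCoAngular S.toFunctor _).2 h2.1, h2.2⟩

/-- Post-composition with an isomorphism preserves co-angular pre-steps (operations language).
[cite: MochizukiFrdI2008, Def. 1.3 (iii) p.25] -/
theorem isCoAngularPreStep_comp_iso {A X X' : E} {φ : A ⟶ X} (hφ : S.IsCoAngularPreStep φ)
    (c : X ⟶ X') [IsIso c] : S.IsCoAngularPreStep (φ ≫ c) := by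
  have h1 : PreFrobenioid.IsCoAngularPreStep S.toFunctor φ :=
    ⟨(PreFrobenioidData.ofFunctor_isCoAngular S.toFunctor φ).1 hφ.1, hφ.2⟩
  have h2 := h1.comp_iso c
  exact ⟨(PreFrobenioidData.ofFunctor_isCoAngular S.toFunctor _).2 h2.1, h2.2⟩

/-- Co-angular pre-steps are stable under isomorphism of arrows (operations language).
[cite: MochizukiFrdI2008, Def. 1.3 (iii) p.25] -/
theorem isCoAngularPreStep_of_arrow_iso {X X' Y Y' : E} {ψ : X ⟶ Y} {ψ' : X' ⟶ Y'}
    (hψ : S.IsCoAngularPreStep ψ) (eX : X ≅ X') (eY : Y ≅ Y') (hw : eX.hom ≫ ψ' = ψ ≫ eY.hom) :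
    S.IsCoAngularPreStep ψ' := by
  have : ψ' = eX.inv ≫ ψ ≫ eY.hom := (Iso.eq_inv_comp eX).2 hw
  rw [this]
  exact isCoAngularPreStep_iso_comp S eX.inv (isCoAngularPreStep_comp_iso S hψ eY.hom)

end OpsIso

/-! ### §2 The transport engine for `IsLimitOfOTriLike` -/

section Engine

variable {D₀ : Type u₀} [Category.{v₀} D₀] {V : FrdIMonoidStub.{w}}
  {T : RealifiedDivisorMonoids (D₀ := D₀) V} {D : Type u} [Category.{v} D] {VD : FrdICatStub.{u, v, w} D}
  {D₀' : Type u₀} [Category.{v₀} D₀'] {T' : RealifiedDivisorMonoids (D₀ := D₀') V}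
  {D' : Type u} [Category.{v} D'] {VD' : FrdICatStub.{u, v, w} D'}
  {C : TemperedFrobenioid T D VD} {C' : TemperedFrobenioid T' D' VD'}
  (P : PerfectionData C.opsData) (P' : PerfectionData C'.opsData)

open TemperedFrobenioid

/-- ENGINE: an equivalence `Γ` between categories of co-angular pre-steps over `B`, `B'` that carries
"O^▷-like" pre-steps to "O^▷-like" pre-steps transports the limit criterion `IsLimitOfOTriLike` from `ψ`
to any `ψ'` whose object is isomorphic to the image of `ψ`'s. [cite: MochizukiEtTh2009, Cor 3.8 p.81] -/
theorem isLimitOfOTriLike_transport {B : P.Pf} {B' : P'.Pf} (Γ : CoaPreOver P B ⥤ CoaPreOver P' B')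
    [Γ.IsEquivalence]
    (hΓ : ∀ U : CoaPreOver P B, IsOTriLikePreStep P U.obj.hom → IsOTriLikePreStep P' (Γ.obj U).obj.hom)
    {X : P.Pf} {ψ : X ⟶ B} (hψ : P.ops.IsCoAngularPreStep ψ) {X' : P'.Pf} {ψ' : X' ⟶ B'}
    (hψ' : P'.ops.IsCoAngularPreStep ψ') (i : Γ.obj ⟨Over.mk ψ, hψ⟩ ≅ ⟨Over.mk ψ', hψ'⟩)
    (hlim : IsLimitOfOTriLike P ψ) : IsLimitOfOTriLike P' ψ' := by
  obtain ⟨hψ₀, J, _, _, F, π, hF, ⟨hl⟩⟩ := hlim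
  let c : Cone F := Cone.mk _ π
  have h₁ : IsLimit (Γ.mapCone c) := isLimitOfPreserves Γ hl
  let c₂ : Cone (F ⋙ Γ) :=
    { pt := ⟨Over.mk ψ', hψ'⟩
      π := { app := fun j => i.inv ≫ (Γ.mapCone c).π.app j
             naturality := fun j j' f => by
               rw [Category.assoc]
               erw [Category.id_comp]
               simp only [Functor.mapCone_π_app, Functor.comp_map]
               congr 1
               rw [← c.w f, Γ.map_comp]
               rfl } }
  have h₂ : IsLimit c₂ :=
    IsLimit.ofIsoLimit h₁ (Cone.ext i (fun j => (Iso.hom_inv_id_assoc i _).symm))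
  exact ⟨hψ', J, inferInstance, inferInstance, F ⋙ Γ, c₂.π, fun j => hΓ _ (hF j), ⟨h₂⟩⟩

end Engine


/-! ### §3a Transport along an equivalence of perfections preserving co-angular pre-steps and `O^▷(−)` -/

section AlongEquivalence

variable {D₀ : Type u₀} [Category.{v₀} D₀] {V : FrdIMonoidStub.{w}}
  {T : RealifiedDivisorMonoids (D₀ := D₀) V} {D : Type u} [Category.{v} D] {VD : FrdICatStub.{u, v, w} D}
  {D₀' : Type u₀} [Category.{v₀} D₀'] {T' : RealifiedDivisorMonoids (D₀ := D₀') V}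
  {D' : Type u} [Category.{v} D'] {VD' : FrdICatStub.{u, v, w} D'}
  {C : TemperedFrobenioid T D VD} {C' : TemperedFrobenioid T' D' VD'}
  (P : PerfectionData C.opsData) (P' : PerfectionData C'.opsData) (G : P.Pf ≌ P'.Pf)
  (hG : PreFrobenioidData.PreservesMor G.functor P.ops.IsCoAngularPreStep P'.ops.IsCoAngularPreStep)
  (hG' : PreFrobenioidData.PreservesMor G.inverse P'.ops.IsCoAngularPreStep P.ops.IsCoAngularPreStep)

open TemperedFrobenioid

/-- The functor `(C^pf)^coa-pre_B → (C'^pf)^coa-pre_{G B}` induced by an equivalence `G` carrying co-angular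
pre-steps to co-angular pre-steps: `Over.post G` restricted to the full subcategories. (bookkeeping)
[cite: MochizukiEtTh2009, Cor 3.8 p.81] -/
noncomputable def postCoa (B : P.Pf) : CoaPreOver P B ⥤ CoaPreOver P' (G.functor.obj B) :=
  ObjectProperty.lift _ (ObjectProperty.ι _ ⋙ Over.post G.functor) fun U => hG _ U.property

include hG

/-- `postCoa` on objects (bookkeeping). [cite: MochizukiEtTh2009, Cor 3.8 p.81] -/
theorem postCoa_obj_obj_hom {B : P.Pf} (U : CoaPreOver P B) :
    ((postCoa P P' G hG B).obj U).obj.hom = G.functor.map U.obj.hom := rfl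

/-- `postCoa` on morphisms: the underlying arrow is `G` applied to the underlying arrow. (bookkeeping)
[cite: MochizukiEtTh2009, Cor 3.8 p.81] -/
theorem postCoa_map_hom_left {B : P.Pf} {U U' : CoaPreOver P B} (a : U ⟶ U') :
    ((postCoa P P' G hG B).map a).hom.left = G.functor.map a.hom.left := rfl

include hG' in
/-- `postCoa` is an equivalence of categories (faithful, full, essentially surjective — the latter via
`G⁻¹` and the unit/counit of `G`). [cite: MochizukiEtTh2009, Cor 3.8 p.81] -/
theorem postCoa_isEquivalence (B : P.Pf) : (postCoa P P' G hG B).IsEquivalence := by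
  refine ⟨⟨fun {U U'} a b hab => ?_⟩, ⟨fun {U U'} k => ?_⟩, ⟨fun W => ?_⟩⟩
  · -- faithful
    apply ObjectProperty.hom_ext; apply Over.OverMorphism.ext
    apply G.functor.map_injective
    exact congrArg (fun t : (postCoa P P' G hG B).obj U ⟶ (postCoa P P' G hG B).obj U' => t.hom.left) hab
  · -- full
    let f : U.obj.left ⟶ U'.obj.left := G.functor.preimage k.hom.left
    have hf : f ≫ U'.obj.hom = U.obj.hom := by
      apply G.functor.map_injective
      rw [Functor.map_comp, Functor.map_preimage]
      exact Over.w k.hom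
    refine ⟨ObjectProperty.homMk (Over.homMk f hf), ?_⟩
    apply ObjectProperty.hom_ext; apply Over.OverMorphism.ext
    change G.functor.map f = k.hom.left
    exact Functor.map_preimage _ _
  · -- essentially surjective
    have hψ₀ : P.ops.IsCoAngularPreStep (G.inverse.map W.obj.hom ≫ (G.unitIso.app B).inv) :=
      isCoAngularPreStep_comp_iso P.ops (hG' _ W.property) _
    let U₀ : CoaPreOver P B := ⟨Over.mk (G.inverse.map W.obj.hom ≫ (G.unitIso.app B).inv), hψ₀⟩
    have hw : (G.counitIso.app W.obj.left).hom ≫ W.obj.hom =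
        G.functor.map (G.inverse.map W.obj.hom ≫ (G.unitIso.app B).inv) := by
      have nat := G.counit.naturality W.obj.hom
      simp only [Functor.comp_map, Functor.id_map] at nat
      have key : G.functor.map ((G.unitIso.app B).inv) = G.counit.app (G.functor.obj B) := by
        rw [Iso.app_inv]; exact (G.counit_app_functor B).symm
      have step : G.functor.map (G.inverse.map W.obj.hom) ≫ G.counit.app (G.functor.obj B) =
          G.functor.map (G.inverse.map W.obj.hom) ≫ G.functor.map ((G.unitIso.app B).inv) :=
        congrArg (fun x => G.functor.map (G.inverse.map W.obj.hom) ≫ x) key.symm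
      rw [Functor.map_comp]
      exact nat.symm.trans step
    let e : ((postCoa P P' G hG B).obj U₀).obj ≅ W.obj := Over.isoMk (G.counitIso.app W.obj.left) hw
    exact ⟨U₀, ⟨(ObjectProperty.fullyFaithfulι _).preimageIso e⟩⟩

/-- Along `postCoa`, "O^▷-like" pre-steps go to "O^▷-like" pre-steps, provided `G` also carries `O^▷(−)`
into `O^▷(−)`. [cite: MochizukiEtTh2009, Cor 3.8 p.81] -/
theorem isOTriLikePreStep_map
    (hGe : ∀ (X : P.Pf) (ε : End X), ε ∈ P.ops.endSubmonoid X →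
      (G.functor.map ε : End (G.functor.obj X)) ∈ P'.ops.endSubmonoid (G.functor.obj X))
    {X Y : P.Pf} {θ : X ⟶ Y} (hθ : IsOTriLikePreStep P θ) : IsOTriLikePreStep P' (G.functor.map θ) := by
  obtain ⟨hcoa, A'', ε, hε, ⟨e⟩⟩ := hθ
  refine ⟨hG _ hcoa, G.functor.obj A'', G.functor.map ε, hGe _ _ hε, ⟨?_⟩⟩
  let eL : X ≅ A'' := ⟨e.hom.left, e.inv.left, Arrow.hom_inv_id_left e, Arrow.inv_hom_id_left e⟩
  let eR : Y ≅ A'' := ⟨e.hom.right, e.inv.right, Arrow.hom_inv_id_right e, Arrow.inv_hom_id_right e⟩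
  have hw : eL.hom ≫ ε = θ ≫ eR.hom := Arrow.w e.hom
  refine Arrow.isoMk' (G.functor.map θ) (G.functor.map ε) (G.functor.mapIso eL) (G.functor.mapIso eR) ?_
  rw [Functor.mapIso_hom, Functor.mapIso_hom, ← Functor.map_comp, ← Functor.map_comp, hw]

include hG' in
/-- **Transport along `G`**: `IsLimitOfOTriLike P ψ → IsLimitOfOTriLike P' (G ψ)`.
[cite: MochizukiEtTh2009, Cor 3.8 p.81] -/
theorem isLimitOfOTriLike_map
    (hGe : ∀ (X : P.Pf) (ε : End X), ε ∈ P.ops.endSubmonoid X →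
      (G.functor.map ε : End (G.functor.obj X)) ∈ P'.ops.endSubmonoid (G.functor.obj X))
    {X B : P.Pf} {ψ : X ⟶ B} (h : IsLimitOfOTriLike P ψ) : IsLimitOfOTriLike P' (G.functor.map ψ) := by
  obtain ⟨hψ, _⟩ := id h
  haveI := postCoa_isEquivalence P P' G hG hG' B
  exact isLimitOfOTriLike_transport P P' (postCoa P P' G hG B)
    (fun U hU => isOTriLikePreStep_map P P' G hG hGe hU) hψ (hG _ hψ) (Iso.refl _) h

end AlongEquivalence


/-! ### §3b Invariance of the criterion under isomorphism of arrows (one perfection) -/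

section ArrowIso

variable {D₀ : Type u₀} [Category.{v₀} D₀] {V : FrdIMonoidStub.{w}}
  {T : RealifiedDivisorMonoids (D₀ := D₀) V} {D : Type u} [Category.{v} D] {VD : FrdICatStub.{u, v, w} D}
  {C : TemperedFrobenioid T D VD} (P : PerfectionData C.opsData)

open TemperedFrobenioid

/-- `(C^pf)^coa-pre_B → (C^pf)^coa-pre_{B'}` along an isomorphism `B ≅ B'`: `Over.map` restricted.
(bookkeeping) [cite: MochizukiEtTh2009, Cor 3.8 p.81] -/
noncomputable def mapCoa {B B' : P.Pf} (eB : B ≅ B') : CoaPreOver P B ⥤ CoaPreOver P B' :=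
  ObjectProperty.lift _ (ObjectProperty.ι _ ⋙ Over.map eB.hom)
    fun U => isCoAngularPreStep_comp_iso P.ops U.property eB.hom

/-- `mapCoa` is an equivalence of categories. [cite: MochizukiEtTh2009, Cor 3.8 p.81] -/
theorem mapCoa_isEquivalence {B B' : P.Pf} (eB : B ≅ B') : (mapCoa P eB).IsEquivalence := by
  refine ⟨⟨fun {U U'} a b hab => ?_⟩, ⟨fun {U U'} k => ?_⟩, ⟨fun W => ?_⟩⟩
  · apply ObjectProperty.hom_ext; apply Over.OverMorphism.ext
    exact congrArg (fun t : (mapCoa P eB).obj U ⟶ (mapCoa P eB).obj U' => t.hom.left) hab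
  · have hk : k.hom.left ≫ U'.obj.hom = U.obj.hom := by
      have this : k.hom.left ≫ (U'.obj.hom ≫ eB.hom) = U.obj.hom ≫ eB.hom := Over.w k.hom
      rw [← Category.assoc] at this
      exact (cancel_mono eB.hom).1 this
    refine ⟨ObjectProperty.homMk (Over.homMk k.hom.left hk), ?_⟩
    apply ObjectProperty.hom_ext; apply Over.OverMorphism.ext
    rfl
  · have hψ₀ : P.ops.IsCoAngularPreStep (W.obj.hom ≫ eB.inv) :=
      isCoAngularPreStep_comp_iso P.ops W.property _
    let U₀ : CoaPreOver P B := ⟨Over.mk (W.obj.hom ≫ eB.inv), hψ₀⟩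
    let e : ((mapCoa P eB).obj U₀).obj ≅ W.obj :=
      Over.isoMk (Iso.refl _) (by change 𝟙 _ ≫ W.obj.hom = (W.obj.hom ≫ eB.inv) ≫ eB.hom; simp)
    exact ⟨U₀, ⟨(ObjectProperty.fullyFaithfulι _).preimageIso e⟩⟩

/-- Along `mapCoa`, "O^▷-like" pre-steps go to "O^▷-like" pre-steps. [cite: MochizukiEtTh2009, Cor 3.8 p.81] -/
theorem isOTriLikePreStep_comp_iso {X B B' : P.Pf} {θ : X ⟶ B} (hθ : IsOTriLikePreStep P θ)
    (eB : B ≅ B') : IsOTriLikePreStep P (θ ≫ eB.hom) := by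
  obtain ⟨hcoa, A'', ε, hε, ⟨e⟩⟩ := hθ
  refine ⟨isCoAngularPreStep_comp_iso P.ops hcoa _, A'', ε, hε, ⟨?_ ≪≫ e⟩⟩
  exact Arrow.isoMk' (θ ≫ eB.hom) θ (Iso.refl _) eB.symm (by simp)

/-- **Invariance under isomorphism of arrows**: `IsLimitOfOTriLike P ψ → IsLimitOfOTriLike P ψ'` whenever
`(eX, eB) : ψ ≅ ψ'` in the arrow category. [cite: MochizukiEtTh2009, Cor 3.8 p.81] -/
theorem isLimitOfOTriLike_of_arrow_iso {X X' B B' : P.Pf} {ψ : X ⟶ B} {ψ' : X' ⟶ B'} (eX : X ≅ X')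
    (eB : B ≅ B') (hw : eX.hom ≫ ψ' = ψ ≫ eB.hom) (h : IsLimitOfOTriLike P ψ) : IsLimitOfOTriLike P ψ' := by
  obtain ⟨hψ, _⟩ := id h
  have hψ' : P.ops.IsCoAngularPreStep ψ' := isCoAngularPreStep_of_arrow_iso P.ops hψ eX eB hw
  haveI := mapCoa_isEquivalence P eB
  let i₀ : ((mapCoa P eB).obj ⟨Over.mk ψ, hψ⟩).obj ≅ Over.mk ψ' := Over.isoMk eX hw
  exact isLimitOfOTriLike_transport P P (mapCoa P eB) (fun U hU => isOTriLikePreStep_comp_iso P hU eB)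
    hψ hψ' ((ObjectProperty.fullyFaithfulι _).preimageIso i₀) h

end ArrowIso


end Cor38Transport

/-! ### §4 Assembly: C38-L06 ⟸ C38-L02a, L03, L04, L05 -/

section Assembly

variable {D₀ : Type u₀} [Category.{v₀} D₀] {V : FrdIMonoidStub.{w}}
  {T : RealifiedDivisorMonoids (D₀ := D₀) V} {D : Type u} [Category.{v} D] {VD : FrdICatStub.{u, v, w} D}
  {D₀' : Type u₀} [Category.{v₀} D₀'] {T' : RealifiedDivisorMonoids (D₀ := D₀') V}
  {D' : Type u} [Category.{v} D'] {VD' : FrdICatStub.{u, v, w} D'}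
  {C₁ : TemperedFrobenioid T D VD} {C₂ : TemperedFrobenioid T' D' VD'} (h : Cor38Hyp C₁ C₂)

open TemperedFrobenioid Cor38Transport

/-- **C38-L06 derivation PROVED** (p.81, "Thus, `Ψ` preserves the base-field-theoretic pre-steps"): the
criterion C38-L05 on both sides is transported along the equivalence `Ψ^pf` of the perfections (which
preserves co-angular pre-steps and `O^▷(−)`, [FrdI] Thm. 3.4 (ii)/(iv) for the perfections) and along the
`1`-commutative square `Ψ^pf ∘ (C₁ → C₁^pf) ≅ (C₂ → C₂^pf) ∘ Ψ`. [cite: MochizukiEtTh2009, Cor 3.8 p.81] -/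
theorem Cor38Hyp.preservesBsFldPreSteps_of_criterion (P₁ : PerfectionData C₁.opsData)
    (P₂ : PerfectionData C₂.opsData) : h.PreservesBsFldPreStepsOfCriterion P₁ P₂ := by
  intro hps hc₁ hc₂ G hcomm hG hG' hGe hGe'
  obtain ⟨e⟩ := hcomm
  -- transport along `G = Ψ^pf` (and back along `G⁻¹`, then along the unit isomorphism)
  have key : ∀ {X B : P₁.Pf} (ψ : X ⟶ B),
      IsLimitOfOTriLike P₁ ψ ↔ IsLimitOfOTriLike P₂ (G.functor.map ψ) := by
    intro X B ψ
    refine ⟨fun hl => isLimitOfOTriLike_map P₁ P₂ G hG hG' hGe hl, fun hl => ?_⟩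
    have h1 : IsLimitOfOTriLike P₁ (G.inverse.map (G.functor.map ψ)) :=
      isLimitOfOTriLike_map P₂ P₁ G.symm hG' hG hGe' hl
    refine isLimitOfOTriLike_of_arrow_iso P₁ (G.unitIso.app X).symm (G.unitIso.app B).symm ?_ h1
    exact (G.unitIso.inv.naturality ψ).symm
  -- the square `Ψ ⋙ toPf₂ ≅ toPf₁ ⋙ G` as isomorphisms of arrows
  have key2 : ∀ {A B : C₁.category} (φ : A ⟶ B),
      IsLimitOfOTriLike P₂ (P₂.toPf.map (h.Ψ.functor.map φ)) ↔
        IsLimitOfOTriLike P₂ (G.functor.map (P₁.toPf.map φ)) := by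
    intro A B φ
    constructor
    · intro hl
      exact isLimitOfOTriLike_of_arrow_iso P₂ (e.app A) (e.app B) (e.hom.naturality φ).symm hl
    · intro hl
      exact isLimitOfOTriLike_of_arrow_iso P₂ (e.app A).symm (e.app B).symm (e.inv.naturality φ).symm hl
  -- Part 1: `Ψ`
  have part1 : ∀ {A B : C₁.category} (φ : A ⟶ B), C₁.opsData.IsPreStep φ →
      (C₁.IsBaseFieldTheoretic φ ↔ C₂.IsBaseFieldTheoretic (h.Ψ.functor.map φ)) := by
    intro A B φ hφ
    rw [hc₁ φ hφ, hc₂ _ (hps.1 φ hφ), key2, key]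
  refine ⟨fun A B φ hφ => part1 φ hφ, fun A B φ hφ => ?_⟩
  -- Part 2: `Ψ⁻¹`, through `Ψ (Ψ⁻¹ φ) ≅ φ` (counit) mapped to `C₂^pf`
  have hφ₁ : C₁.opsData.IsPreStep (h.Ψ.inverse.map φ) := hps.2 φ hφ
  have hφ₂ : C₂.opsData.IsPreStep (h.Ψ.functor.map (h.Ψ.inverse.map φ)) := hps.1 _ hφ₁
  rw [part1 _ hφ₁, hc₂ φ hφ, hc₂ _ hφ₂]
  constructor
  · intro hl
    refine isLimitOfOTriLike_of_arrow_iso P₂ (P₂.toPf.mapIso (h.Ψ.counitIso.app A).symm)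
      (P₂.toPf.mapIso (h.Ψ.counitIso.app B).symm) ?_ hl
    have nat := congrArg P₂.toPf.map (h.Ψ.counitIso.inv.naturality φ)
    simp only [Functor.id_map, Functor.comp_map, Functor.map_comp] at nat
    simp only [Functor.mapIso_hom, Iso.symm_hom, Iso.app_inv]
    exact nat.symm
  · intro hl
    refine isLimitOfOTriLike_of_arrow_iso P₂ (P₂.toPf.mapIso (h.Ψ.counitIso.app A))
      (P₂.toPf.mapIso (h.Ψ.counitIso.app B)) ?_ hl
    have nat := congrArg P₂.toPf.map (h.Ψ.counitIso.hom.naturality φ)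
    simp only [Functor.id_map, Functor.comp_map, Functor.map_comp] at nat
    simp only [Functor.mapIso_hom, Iso.app_hom]
    exact nat.symm

end Assembly

end Literature.AnabelianGeometry.EtaleTheta
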